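import Summits.ValiantsHypothesis.ValiantsHypothesis.Theorems.SymPencilPerFourInnerRankTenFamily

/-!
# Route `SymPencil` — inner rank of the `2 | 2` row split of `per_4`: the PURE case needs
# twelve squares as soon as the symmetrised `y₂`-block vectors are isotropic
# (`--supports` stmt-ValiantsHypothesis-5674 `SdcSuperquadratic`; (8,8) column of the size
# tables, cells `(8,8,10)` / `(8,8,11)`; rung currency only)

**Theorem** (`false_of_allX_of_symmIso`).  Over a field of characteristic `0`, let
`Σ_r c_r t_r((a,b),(y₂,y₃))² = per (a; b; y₂; y₃)` with `|ι| ≤ 11` squares, and suppose the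
design is PURE (all columns of type `X`: the `y₂`-block of `t` depends only on `b`, the
`y₃`-block only on `a`).  If moreover the single scalar family of identities
`Σ_r c_r t_r((0,b),(y,0)) t_r((0,y),(b,0)) = 0` (`b, y ∈ K⁴`) holds — "the vectors
`n(b,y) + n(y,b)` are isotropic", where `n(b,y) = (t_r((0,b),(y,0)))_r ∈ K^ι` — then we reach a
contradiction.  This generalises `SymPencilPerFourInnerRankTen.false_of_allX`, which needs the
"family facts" `n_{jj} = 0`, `n_{jk} = n_{kj}` (vector identities, available only through the
kernel lemma at `|ι| ≤ 9`); here ONE scalar family suffices, and no non-vanishing of the weights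
is used.

Proof.  Polarising the hypothesis twice and combining with the isotropy relations
`⟨n_{jk}, n_{j'k'}⟩ + ⟨n_{j'k}, n_{jk'}⟩ = 0` (which follow from the identity alone) shows that the
six symmetrised vectors `N̂_S = n_{pq} + n_{qp}` (`S = {p,q}`) span a totally isotropic subspace for
`⟨x,y⟩ = Σ c_r x_r y_r`; they pair with the `m_{il} = t((e_i,0),(0,e_l))` as
`⟨N̂_S, m_{il}⟩ = [{i,l} = Sᶜ]`, so they are linearly independent and lie in the kernel of the
surjection `x ↦ (⟨N̂_S, x⟩)_S : K^ι → K⁶`: `6 ≤ |ι| - 6`.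

Role (see `Cruxes/SdcSuperquadratic/INNER-RANK-TEN.md` and the memo
`NOTE-p6g15-5674-IR12-reduction.md` on the item): the (8,8) column residue IR10/IR11 reduces to the
pure Gram problem "pure designs need 12 squares"; this file records that the pure Gram problem in
turn is equivalent to the vanishing of the quadratic form `c(ξ,ξ)` on decomposable 2-vectors,
i.e. to the hypothesis `hsym` below.  Honest framing: a CONDITIONAL reduction inside one cell of
the size tables; `(8,8,10)`, `(8,8,11)` stay open; the window `27 ≤ sdc(per_4) ≤ 29`, the crux
`SdcSuperquadratic` and `VP ≠ VNP` are untouched.  No definitions, no named facts. [folklore]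
-/

noncomputable section

-- single-conjunct layout: Sub = Summit, duplicated namespace component intended
set_option linter.dupNamespace false

namespace Summit.ValiantsHypothesis.ValiantsHypothesis.Theorems.SymPencilPerFourInnerRankPureSymm

open Matrix Finset Module
open Summit.ValiantsHypothesis.ValiantsHypothesis.Theorems.SymPencilPerFourInnerRankRows
open Summit.ValiantsHypothesis.ValiantsHypothesis.Theorems.SymPencilPerFourInnerRankTenFamily

variable {K : Type*} [Field K] {ι : Type*} [Fintype ι]

/-- **Pure designs with isotropic symmetrised `y₂`-block vectors need twelve squares.**  With
`|ι| ≤ 11`, purity (`hX`) and the scalar family `hsym`, the joint identity `hJ` is contradictory.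
See the module docstring for the proof. [folklore] -/
theorem false_of_allX_of_symmIso [CharZero K] [DecidableEq ι] (hι : Fintype.card ι ≤ 11)
    (c : ι → K)
    (t : ι → (((Fin 4 → K) × (Fin 4 → K)) →ₗ[K] ((Fin 4 → K) × (Fin 4 → K)) →ₗ[K] K))
    (hJ : ∀ a b y₂ y₃ : Fin 4 → K,
      ∑ r, c r * (t r (a, b) (y₂, y₃)) ^ 2 = (Matrix.of ![a, b, y₂, y₃]).permanent)
    (hX : ∀ k : Fin 4, (∀ (a : Fin 4 → K) r, t r (a, 0) (Pi.single k 1, 0) = 0) ∧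
        (∀ (b : Fin 4 → K) r, t r (0, b) (0, Pi.single k 1) = 0))
    (hsym : ∀ b y : Fin 4 → K,
      ∑ r, c r * t r (0, b) (y, 0) * t r (0, y) (b, 0) = 0) : False := by
  have hsplit : ∀ (a b : Fin 4 → K) (y : (Fin 4 → K) × (Fin 4 → K)) r,
      t r (a, b) y = t r (a, 0) y + t r (0, b) y := fun a b y r => by
    rw [← LinearMap.add_apply, ← map_add]; simp
  -- the vectors `n(b,y)`, `n_{jk}`, `m_{il}` and the pairing `B`
  set nv : (Fin 4 → K) → (Fin 4 → K) → ι → K := fun b y r => t r (0, b) (y, 0) with hnv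
  set n : Fin 4 → Fin 4 → ι → K := fun j k r => t r (0, Pi.single j 1) (Pi.single k 1, 0)
    with hn
  set m : Fin 4 → Fin 4 → ι → K := fun i l r => t r (Pi.single i 1, 0) (0, Pi.single l 1)
    with hm
  set B : (ι → K) → (ι → K) → K := fun x y => ∑ r, c r * x r * y r with hB
  have Bsymm : ∀ x y, B x y = B y x := fun x y => Finset.sum_congr rfl fun r _ => by ring
  have hn_nv : ∀ j k, n j k = nv (Pi.single j 1) (Pi.single k 1) := fun j k => rfl
  -- bilinearity of `nv`
  have nv_add_left : ∀ b b' y, nv (b + b') y = nv b y + nv b' y := fun b b' y => by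
    funext r
    simp only [hnv, Pi.add_apply]
    rw [show (((0 : Fin 4 → K), b + b') : (Fin 4 → K) × (Fin 4 → K)) = (0, b) + (0, b') by simp,
      map_add, LinearMap.add_apply]
  have nv_add_right : ∀ b y y', nv b (y + y') = nv b y + nv b y' := fun b y y' => by
    funext r
    simp only [hnv, Pi.add_apply]
    rw [show ((y + y', (0 : Fin 4 → K)) : (Fin 4 → K) × (Fin 4 → K)) = (y, 0) + (y', 0) by simp,
      map_add]
  have B_add_left : ∀ x x' y, B (x + x') y = B x y + B x' y := fun x x' y => by
    simp only [hB, Pi.add_apply, ← Finset.sum_add_distrib]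
    exact Finset.sum_congr rfl fun r _ => by ring
  have B_add_right : ∀ x y y', B x (y + y') = B x y + B x y' := fun x y y' => by
    rw [Bsymm, B_add_left, Bsymm y, Bsymm y']
  -- the hypothesis, polarised twice
  have hsym' : ∀ b y, B (nv b y) (nv y b) = 0 := fun b y => hsym b y
  have P1 : ∀ b b' y, B (nv b y) (nv y b') + B (nv b' y) (nv y b) = 0 := by
    intro b b' y
    have h := hsym' (b + b') y
    rw [nv_add_left, nv_add_right, B_add_left, B_add_right, B_add_right, hsym' b y,
      hsym' b' y] at h
    linear_combination h
  have P2 : ∀ b b' y y', B (nv b y) (nv y' b') + B (nv b y') (nv y b') +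
      (B (nv b' y) (nv y' b) + B (nv b' y') (nv y b)) = 0 := by
    intro b b' y y'
    have h := P1 b b' (y + y')
    rw [nv_add_right, nv_add_right, nv_add_left, nv_add_left, B_add_left, B_add_left,
      B_add_right, B_add_right, B_add_right, B_add_right] at h
    have h1 := P1 b b' y
    have h2 := P1 b b' y'
    linear_combination h - h1 - h2
  -- Gram pairing against the `m`'s (purity)
  have gram : ∀ i j k l : Fin 4, 2 * B (n j k) (m i l) =
      (Matrix.of ![Pi.single i (1 : K), Pi.single j 1, Pi.single k 1, Pi.single l 1]).permanent := by
    intro i j k l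
    have h := polar c t hJ (Pi.single i 1) (Pi.single j 1) (Pi.single k 1) 0 0 (Pi.single l 1)
    rw [per_zero_row₂, add_zero] at h
    have h1 : ∀ r, t r (Pi.single i 1, Pi.single j 1) (Pi.single k 1, 0) = n j k r := fun r => by
      rw [hsplit, (hX k).1, zero_add]
    have h2 : ∀ r, t r (Pi.single i 1, Pi.single j 1) (0, Pi.single l 1) = m i l r := fun r => by
      rw [hsplit, (hX l).2, add_zero]
    simp_rw [h1, h2] at h
    exact h
  -- row/column isotropy for general vectors: `⟨n(b,y), n(b',y')⟩ + ⟨n(b',y), n(b,y')⟩ = 0`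
  have isoV : ∀ b b' y y', B (nv b y) (nv b' y') + B (nv b' y) (nv b y') = 0 := by
    intro b b' y y'
    have hd : ∀ bb y y' : Fin 4 → K, B (nv bb y) (nv bb y') = 0 := fun bb y y' => by
      have h' := polar c t hJ 0 bb y 0 y' 0
      rw [per_zero_row₀, per_zero_row₀, add_zero] at h'
      exact (mul_eq_zero.1 h').resolve_left two_ne_zero
    have h := hd (b + b') y y'
    rw [nv_add_left, nv_add_left, B_add_left, B_add_right, B_add_right, hd b, hd b', zero_add,
      add_zero] at h
    exact h
  -- the symmetrised vectors `n(b,y) + n(y,b)` span a totally isotropic subspace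
  have isoHatV : ∀ b y b' y', B (nv b y + nv y b) (nv b' y' + nv y' b') = 0 := by
    intro b y b' y'
    have Ea := P2 b y' y b'
    have Eb := P2 y b' b y'
    have Ec := P2 b b' y y'
    have I1 := isoV b y b' y'
    have I2 := isoV y' b' y b
    have I3 := isoV y b y' b'
    have I4 := isoV b' y' b y
    rw [Bsymm (nv y' b') (nv y b)] at Ea
    rw [Bsymm (nv b' y') (nv b y)] at Eb
    rw [Bsymm (nv b' y') (nv y b)] at Ec
    rw [Bsymm (nv y b') (nv b y')] at I1
    rw [Bsymm (nv y' b) (nv b' y)] at I4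
    rw [B_add_left, B_add_right, B_add_right]
    linear_combination Ea / 2 + Eb / 2 + Ec - I1 / 2 - I2 / 2 - I3 / 2 - I4 / 2
  -- six `N̂`'s and six `m`'s in complementary order
  set N6 : Fin 6 → ι → K :=
    ![n 0 1 + n 1 0, n 0 2 + n 2 0, n 0 3 + n 3 0, n 1 2 + n 2 1, n 1 3 + n 3 1, n 2 3 + n 3 2]
    with hN6
  set M6 : Fin 6 → ι → K := ![m 2 3, m 1 3, m 1 2, m 0 3, m 0 2, m 0 1] with hM6
  have h6 : ∀ S : Fin 6, S = 0 ∨ S = 1 ∨ S = 2 ∨ S = 3 ∨ S = 4 ∨ S = 5 := by decide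
  have gramHat : ∀ i p q l : Fin 4, B (n p q + n q p) (m i l) =
      ((Matrix.of ![Pi.single i (1 : K), Pi.single p 1, Pi.single q 1, Pi.single l 1]).permanent
        + (Matrix.of ![Pi.single i (1 : K), Pi.single q 1, Pi.single p 1, Pi.single l 1]).permanent)
          / 2 := by
    intro i p q l
    rw [B_add_left, ← gram i p q l, ← gram i q p l]
    ring
  have gram6 : ∀ S S' : Fin 6, B (N6 S) (M6 S') = if S = S' then 1 else 0 := by
    intro S S'
    rcases h6 S with rfl | rfl | rfl | rfl | rfl | rfl <;>
      rcases h6 S' with rfl | rfl | rfl | rfl | rfl | rfl <;>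
      · simp only [hN6, hM6, Matrix.cons_val]
        rw [gramHat, permanent_of_rows, permanent_of_rows]
        simp
        try norm_num
  have iso6 : ∀ S S' : Fin 6, B (N6 S) (N6 S') = 0 := by
    intro S S'
    rcases h6 S with rfl | rfl | rfl | rfl | rfl | rfl <;>
      rcases h6 S' with rfl | rfl | rfl | rfl | rfl | rfl <;>
      · simp only [hN6, Matrix.cons_val, hn_nv]
        exact isoHatV _ _ _ _
  -- `ψ x = (B (N6 S) x)_S`, `χ x = (B x (M6 S))_S`
  let ψ : (ι → K) →ₗ[K] (Fin 6 → K) :=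
    { toFun := fun x S => B (N6 S) x
      map_add' := fun x y => by
        funext S
        simp only [hB, Pi.add_apply, mul_add, Finset.sum_add_distrib]
      map_smul' := fun s x => by
        funext S
        simp only [hB, Pi.smul_apply, smul_eq_mul, RingHom.id_apply, Finset.mul_sum]
        exact Finset.sum_congr rfl fun r _ => by ring }
  have hψ : ∀ x S, ψ x S = B (N6 S) x := fun x S => rfl
  let χ : (ι → K) →ₗ[K] (Fin 6 → K) :=
    { toFun := fun x S => B x (M6 S)
      map_add' := fun x y => by
        funext S
        simp only [hB, Pi.add_apply, mul_add, add_mul, Finset.sum_add_distrib]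
      map_smul' := fun s x => by
        funext S
        simp only [hB, Pi.smul_apply, smul_eq_mul, RingHom.id_apply, Finset.mul_sum]
        exact Finset.sum_congr rfl fun r _ => by ring }
  have hχ : ∀ x S, χ x S = B x (M6 S) := fun x S => rfl
  have hψM : ∀ S', ψ (M6 S') = Pi.single S' 1 := fun S' => by
    funext S
    rw [hψ, gram6, Pi.single_apply]
  have hψN : ∀ S', ψ (N6 S') = 0 := fun S' => by
    funext S
    rw [hψ, iso6, Pi.zero_apply]
  have hχN : ∀ S', χ (N6 S') = Pi.single S' 1 := fun S' => by
    funext S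
    rw [hχ, gram6, Pi.single_apply]
    by_cases h : S' = S
    · rw [if_pos h, if_pos h.symm]
    · rw [if_neg h, if_neg (Ne.symm h)]
  have hsum : ∀ v : Fin 6 → K, ∑ S, v S • (Pi.single S (1 : K) : Fin 6 → K) = v := fun v => by
    funext S
    simp [Finset.sum_apply, Pi.single_apply]
  -- `ψ` is onto, so `dim ker ψ = |ι| - 6`
  have hrange : LinearMap.range ψ = ⊤ := by
    rw [LinearMap.range_eq_top]
    intro v
    refine ⟨∑ S, v S • M6 S, ?_⟩
    rw [map_sum]
    simp_rw [map_smul, hψM]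
    exact hsum v
  have hker : finrank K (LinearMap.ker ψ) + 6 = Fintype.card ι := by
    have h := LinearMap.finrank_range_add_finrank_ker ψ
    rw [hrange, finrank_top, finrank_fintype_fun_eq_card, finrank_fintype_fun_eq_card,
      Fintype.card_fin] at h
    omega
  -- the span of the `N6 S` lies in `ker ψ` but maps onto `K⁶` under `χ`
  set Nsp := Submodule.span K (Set.range N6) with hNsp
  have hle : Nsp ≤ LinearMap.ker ψ := by
    rw [hNsp, Submodule.span_le]
    rintro _ ⟨S', rfl⟩
    exact LinearMap.mem_ker.2 (hψN S')
  have h2 : finrank K Nsp ≤ finrank K (LinearMap.ker ψ) := Submodule.finrank_mono hle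
  have htop : (⊤ : Submodule K (Fin 6 → K)) ≤ Nsp.map χ := by
    intro v _
    rw [← hsum v]
    refine Submodule.sum_mem _ fun S _ => Submodule.smul_mem _ _ ?_
    exact ⟨N6 S, Submodule.subset_span ⟨S, rfl⟩, hχN S⟩
  have h6 : 6 ≤ finrank K Nsp := by
    have h := Submodule.finrank_mono htop
    rw [finrank_top, finrank_fintype_fun_eq_card, Fintype.card_fin] at h
    exact h.trans (Submodule.finrank_map_le χ Nsp)
  omega

end Summit.ValiantsHypothesis.ValiantsHypothesis.Theorems.SymPencilPerFourInnerRankPureSymm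

end
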